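import Summits.QuantumFields.BalabanUV.T4Continuum.Support.NE9LinSizeKP

/-!
# NE9MixedCurrencyKP — the KP clause, the TWO-POINT KP producers and the pinned sum (1.26) in the MIXED currency
# `exp(−(a″·(d(γ) + ν + 1)))` for DECAY EXTRACTION ∕ PIN BUDGET (linear size, (2.27)) with the ENTROPY paid in VOLUME (`y^{#γ}`),
# so that the animal-count constant `2^(ν+1+2^ν)` (= 2²¹ on T⁴) of the d-currency dischargers disappears and the `d = 0` shell of the
# (R0) index set is harmless (refuter PRICING-NE9 v3 §C(5) «ALTERNATIVE needing no support clause», Q-N2-1 ∕ sizing line (R-anim); cell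
# `pub-balaban`, T4-DAG §2 node U3 ∕ §6 NE9; BINDER row NE9 OWNER lineage `b2b-balaban-t4-ne9-p1`, generation 59 — the T31 instancer's lane;
# Summits-side NEW work; nothing printed asserted)

HONEST FRAMING (T4-DAG PAGE 1).  Rung (B)+1 of the FINITE-VOLUME T⁴ programme — NOT infinite volume, NOT a mass gap, NOT the Clay
problem.  NE9 (`T4OutputRate.NE9` ∧ `FadingMemory`) is a cell NEW ESTIMATE, NOT PRINTED in [I] = [Balaban1987RG1] (CMP **109**), [II] =
[Balaban1988RG2Cluster] (CMP **116**), and NOT PROVED here («NE9 ⇐ the named binders»; spine PROVED 0∕9).  HONEST DEPENDENCY (cell line,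
verbatim): continuum YM on T⁴ ⇐ BetaPertH ∧ nine spine estimates (0/9 proved); BetaPertH ⇐ (D1) ∧ (D4) ∧ CAP+tail; G-an2-4 gates asym, D1
and NE2/3/4.  Folklore lattice combinatorics composed with tree theorems BY NAME; every decay bound is a DISPLAYED binder; 0 def, 0 sorry.

WHY (refuter `PRICING-NE9.md` v3 §C, 2026-08-21T05:16Z).  The END of record T31 is currency-free (`a d δv` and the majorant `n` are letters),
but the kernel's stock DISCHARGERS of its binders `hKP` (iii), `hdec`, `hpin` and of the table-Lipschitz letter `lip` read the step
volume over ALL wall-connected cube families (index set (R0), `CubeChart.vol = connFamilies`) and pay the entropy of [II] (1.26) ∕ (2.29)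
IN THE LINEAR SIZE with the κ-FREE constant `2^(ν+1+2^ν)` (`NE9LinSizeEntropy.sum_exp_neg_mul_linSize_le_const`; T⁴: 2²¹), which
absorbs the `d = 0` shell (refuter's count n₀(4) = 329 545 wall-connected families of linear size 0 through a cube) and makes the N2
numbers unrealistic at L = M = 13 (§C(4)).  Print never sums over (R0): [II] p. 8 under (1.26) *«The number O(1) is in fact small,
because we sum over X with d_j(X) ≠ 0, as it follows from our inductive construction»* (R1); and where print DOES resum over all
`Y ∋ b₋` it uses a VOLUME weight: p. 16 after (2.19) *«We use the first exponential factor in (2.19) to bound the sum, and this yields a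
constant O(1). In fact the constant is small for κ₁ large, hence we can bound it by 1»*, the factor being `exp(−¼(κ₁ − 1)M⁻⁴|Y|)`.
§C(5)'s second alternative: carry that volume factor into the majorant ∕ table decay and pay the entropy in volume
(`T4HistoryLipschitzEntropy.kp_of_decay_touch`, `sum_isConn_mul_pow_card_le`: `y·e^{a₁}·e^{Dθ} ≤ θ`), keep the decay weights in the linear
size so that `DecayExtract` = (2.27) (`NE9LinSizeKP.decayExtract_linSize`) and `PinBudget` (`pinBudget_linSize`) are UNCHANGED.  THIS FILE
is that alternative in the kernel:
* §1 **`pinnedSum_le_of_mixedDecay`** (lip side): weights `w Y ≤ αc·y^{#dom Y}·e^{−a·d(dom Y)}` (`a ≥ 0`), domains `adj`-connected when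
  nonempty (degree `≤ D`), injective labelling ⇒ at every cube `Σ_{Y ∋ x} w Y ≤ αc·θ₀` for ANY `θ₀` with `y·e^{Dθ₀} ≤ θ₀` — no `e^{a}` (cube
  currency's defect, F-ne9leaf01-1) and no `2^(ν+1+2^ν)` (d-currency's constant).
* §2 **`kp_of_mixedDecay_touch`** (abstract touch form) and **`kpClause_of_mixedDecay`** (over a support map): majorant
  `m γ′ ≤ ε·y^{#supp γ′}·e^{−a′·d(supp γ′)}`, weights `exp(a₁·#supp + a″·(d(supp) + ν + 1))` (the SAME decay weights as
  `NE9LinSizeKP.kpClause_of_linSizeDecay`, so G1∕G2 are untouched), conditions `0 ≤ a″ ≤ a′`, `y·e^{a₁}·e^{Dθ} ≤ θ`,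
  `ε·e^{a″(ν+1)}·θ·(D+1) ≤ a₁` ⇒ the Kotecký–Preiss clause.  Proof: `kp_of_decay_touch` at `d₁ = 0` for `m̃ := m·e^{a″(d + ν + 1)}`.
* §3 **`twoPointKP_of_avgExpLinear_mixedDecay`**, **`twoPointKP_of_avgEvalExpLinear_box_mixedDecay`** — T31's ∕ the E-faces' binder
  `TwoPointKP` BY NAME (`T4HistoryLipschitzSegment.twoPointKP_of_avgExpLinear`) from the mixed decay of the segment majorant.
* §4 NON-VACUITY AT THE T⁴ LETTERS `ν = 4`, `D = 2ν = 8` with `y = e^{−17}` (= `e^{−¼(κ₁−1)}` at T31's `hκ₁ : 69 ≤ κ₁`): the entropy condition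
  holds with `a₁ = 1`, `θ = 1`; the KP smallness with `a″ = 1` at `ε = 1∕3000` (d-currency: `ε = 10⁻¹²`, `NE9LinSizeKP` §5); the lip-side
  condition with `θ₀ = e^{−16}`.  Illustration of the letters only.
HONEST RIDER (what feeds `y`).  TABLE side (§1): the volume factor is PRINTED TYPE — (2.19) p. 16's first factor on the quadratic form
built from Lemma 2's table.  ACTIVITY side (§2–§3): Lemma 3 (2.38) p. 20 is PURE tree-length decay; print controls the `d = 0` shell of
the activities by `ε₁`-smallness ((2.39)–(2.41) p. 21, «see [26, 67, 25, 50]»), i.e. by an (R0)-type count absorbed into «ε₁ sufficiently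
small» — so a volume factor `y^{#Z}` with `y < e^{−(a₁+D)}` in the ACTIVITY majorant is an instancer's CHOICE (available e.g. from (R1):
`#Z ≤ 2^ν(d(Z) + 1)` converts tree-length decay into volume decay on `d ≥ 1` families), not a quotation; this file proves the
implication, it does not choose.  Nothing about Bałaban's constants is claimed; N2 stays class S.

References (TYPES ∕ loci only): [Balaban1988RG2Cluster] T. Bałaban, CMP **116** (1988) 1–22, (1.26) p. 8, (2.19)–(2.20) p. 16, (2.27)
p. 18, Lemma 3 (2.38) p. 20, (2.39)–(2.41) p. 21; [Balaban1987RG1] T. Bałaban, CMP **109** (1987), p. 257; [KoteckyPreiss1986] R. Kotecký,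
D. Preiss, CMP **103** (1986), (1)–(3); [FriedliVelenik2017] Lemma 3.38.  Imports `NE9LinSizeKP` ONLY; modifies nothing; no END re-wired.
Value = the refuter's §C(5) alternative as kernel letters for the T31 instancer, NOT summit progress.
-/

noncomputable section

namespace Summit.QuantumFields.BalabanUV.T4Continuum.NE9MixedCurrencyKP

open scoped BigOperators
open MeasureTheory
open Literature.MathematicalPhysics.QuantumFieldTheory
open Literature.MathematicalPhysics.QuantumFieldTheory.Balaban1983to89
open Literature.MathematicalPhysics.QuantumFieldTheory.Balaban1983to89.T4OutputRate
open Literature.MathematicalPhysics.QuantumFieldTheory.Balaban1983to89.T4ActivityLipschitz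
open Literature.MathematicalPhysics.QuantumFieldTheory.Balaban1983to89.T4HistoryLipschitzRecursion
open Literature.MathematicalPhysics.QuantumFieldTheory.Balaban1983to89.T4HistoryLipschitzOuter
open Literature.MathematicalPhysics.QuantumFieldTheory.Balaban1983to89.T4HistoryLipschitzActivity
open Literature.MathematicalPhysics.QuantumFieldTheory.Balaban1983to89.T4HistoryLipschitzActivity (ClusterGeom)
open Literature.MathematicalPhysics.QuantumFieldTheory.Balaban1983to89.T4HistoryLipschitzEntropy
open Literature.MathematicalPhysics.QuantumFieldTheory.Balaban1983to89.T4HistoryLipschitzCubeGeometry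
open Literature.MathematicalPhysics.QuantumFieldTheory.Balaban1983to89.T4HistoryLipschitzSegment
open Literature.MathematicalPhysics.QuantumFieldTheory.Balaban1983to89.T4HistoryLipschitzLinearSize
open Summit.QuantumFields.BalabanUV.T4Continuum.NE9LinSizeEntropy

variable {ν : ℕ} {G : Type*} [AddCommGroup G] [One G] [DecidableEq G]

/-! ## §1 The pinned sum (1.26) in the mixed currency (lip side): volume entropy, no `e^{a}`, no `2^(ν+1+2^ν)` -/

section Pinned

variable {F : Type*} [Fintype F] {adj : (Fin ν → G) → (Fin ν → G) → Prop} [DecidableRel adj] [Std.Symm adj] {D : ℕ}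

/-- **THE PINNED SUM (1.26) FROM MIXED DECAY (kernel).**  Weights `w Y ≤ αc·y^{#dom Y}·e^{−a·d(dom Y)}` (`0 ≤ αc`, `0 ≤ y`, `0 ≤ a`;
TYPE: the (2.19)∕(2.20) p. 16 bound on the table entries, volume factor `exp(−¼(κ₁−1)M⁻⁴|Y|)` times `exp(−δκd_k(Y))`), every nonempty
domain `adj`-connected for an adjacency of degree `≤ D`, the domain map injective on nonempty domains, and `y·e^{Dθ₀} ≤ θ₀`: at every
cube `x`, `Σ_{Y : x ∈ dom Y} w Y ≤ αc·θ₀` — the shape of [II] p. 16 *«resummed over all Y ∈ 𝐃_k containing, for example, the point b₋.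
We use the first exponential factor in (2.19) to bound the sum, and this yields a constant O(1) … small for κ₁ large»*.  Proof: drop the
tree-length factor, inject the domains through `x` into the `adj`-connected subsets of their union rooted at `x`, volume entropy
(`T4HistoryLipschitzEntropy.sum_isConn_mul_pow_card_le`). [cite: Balaban1988RG2Cluster, (2.19)-(2.20) p.16 and (1.26) p.8; FriedliVelenik2017, Lemma 3.38] -/
theorem pinnedSum_le_of_mixedDecay (hD : ∀ (a : Fin ν → G) (Q : Finset (Fin ν → G)), (Q.filter (adj a)).card ≤ D)
    {w : F → ℝ} {dom : F → Finset (Fin ν → G)} {αc y a θ₀ : ℝ} (hαc : 0 ≤ αc) (hy : 0 ≤ y) (ha : 0 ≤ a)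
    (hθ₀ : y * Real.exp (D * θ₀) ≤ θ₀)
    (hw : ∀ Y, w Y ≤ αc * y ^ (dom Y).card * Real.exp (-(a * (linSize (dom Y) : ℝ))))
    (hconn : ∀ Y, (dom Y).Nonempty → ∃ b ∈ dom Y, Polymer.IsConn adj (dom Y) b)
    (hinj : Set.InjOn dom {Y | (dom Y).Nonempty}) (x : Fin ν → G) :
    ∑ Y ∈ Finset.univ.filter (fun Y => x ∈ dom Y), w Y ≤ αc * θ₀ := by
  classical
  have hw' : ∀ Y, w Y ≤ αc * y ^ (dom Y).card := fun Y => by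
    refine (hw Y).trans ?_
    have h1 : Real.exp (-(a * (linSize (dom Y) : ℝ))) ≤ 1 := by
      rw [Real.exp_le_one_iff, neg_nonpos]; positivity
    calc αc * y ^ (dom Y).card * Real.exp (-(a * (linSize (dom Y) : ℝ))) ≤ αc * y ^ (dom Y).card * 1 :=
          mul_le_mul_of_nonneg_left h1 (by positivity)
      _ = αc * y ^ (dom Y).card := mul_one _
  calc ∑ Y ∈ Finset.univ.filter (fun Y => x ∈ dom Y), w Y
      ≤ ∑ Y ∈ Finset.univ.filter (fun Y => x ∈ dom Y), αc * y ^ (dom Y).card := Finset.sum_le_sum fun Y _ => hw' Y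
    _ = ∑ X ∈ (Finset.univ.filter (fun Y => x ∈ dom Y)).image dom, αc * y ^ X.card := by
        rw [Finset.sum_image]
        exact fun Y₁ h₁ Y₂ h₂ he => hinj ⟨x, (Finset.mem_filter.1 h₁).2⟩ ⟨x, (Finset.mem_filter.1 h₂).2⟩ he
    _ ≤ ∑ X ∈ (Finset.univ.biUnion dom).powerset.filter (fun X => Polymer.IsConn adj X x), αc * y ^ X.card := by
        refine Finset.sum_le_sum_of_subset_of_nonneg ?_ fun X _ _ => mul_nonneg hαc (pow_nonneg hy _)
        intro X hX
        obtain ⟨Y, hY, rfl⟩ := Finset.mem_image.1 hX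
        have hxY : x ∈ dom Y := (Finset.mem_filter.1 hY).2
        obtain ⟨b, -, hb⟩ := hconn Y ⟨x, hxY⟩
        exact Finset.mem_filter.2 ⟨Finset.mem_powerset.2 (Finset.subset_biUnion_of_mem dom (Finset.mem_univ Y)),
          isConn_reroot hb hxY⟩
    _ ≤ αc * θ₀ := sum_isConn_mul_pow_card_le D hD hαc hy hθ₀ _ x

end Pinned

/-! ## §2 The Kotecký–Preiss clause in the mixed currency -/

section KP

variable {adj : (Fin ν → G) → (Fin ν → G) → Prop} [DecidableRel adj] [Std.Symm adj] {D : ℕ}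

/-- **KOTECKÝ–PREISS FROM MIXED DECAY — TOUCH FORM (kernel; abstract).**  Setting of `T4HistoryLipschitzEntropy.kp_of_decay_touch` (polymers
`γ′ ∈ L` with pairwise distinct `adj`-connected supports in `Λ ⊆ Fin ν → G`, `adj` of degree `≤ D`, incompatibility ⇒ a common or adjacent
cube) with the majorant in the MIXED currency `m(γ′) ≤ ε·y^{#supp γ′}·e^{−a′·d(supp γ′)}` and the weights `a₁·#supp`,
`a″·(d(supp) + (ν+1))` (`a″ ≤ a′`).  If `y·e^{a₁}·e^{Dθ} ≤ θ` (VOLUME entropy — no `2^(ν+1+2^ν)`) and `ε·e^{a″(ν+1)}·θ·(D+1) ≤ a₁`, then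
`Σ_{γ′ ∈ L, γ′ ι γ} m(γ′)·e^{a₁#supp γ′ + a″(d(supp γ′)+ν+1)} ≤ a₁·#supp γ`.  Proof: the tree-length part of the weight is dominated by the
tree-length part of the decay (`a″ ≤ a′`); what is left, `m̃ := m·e^{a″(d+ν+1)} ≤ ε·e^{a″(ν+1)}·y^{#supp}`, is `kp_of_decay_touch` at `d₁ = 0`.
[cite: KoteckyPreiss1986, (1)-(3); Balaban1988RG2Cluster, (2.19)-(2.20) p.16, (2.27) p.18 and (2.39)-(2.41) p.21] -/
theorem kp_of_mixedDecay_touch {P : Type*} {inc : P → P → Prop} [DecidableRel inc]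
    (hD : ∀ (a : Fin ν → G) (Q : Finset (Fin ν → G)), (Q.filter (adj a)).card ≤ D)
    {L : Finset P} {supp : P → Finset (Fin ν → G)} {Λ : Finset (Fin ν → G)} (hsub : ∀ γ' ∈ L, supp γ' ⊆ Λ)
    (hconn : ∀ γ' ∈ L, ∃ a ∈ supp γ', Polymer.IsConn adj (supp γ') a) (hinj : Set.InjOn supp L)
    (htouch : ∀ γ' ∈ L, ∀ γ, inc γ' γ → ∃ x ∈ supp γ, ∃ x' ∈ supp γ', x' = x ∨ adj x x')
    {m : P → ℝ} {ε y a' a'' a₁ θ : ℝ} (hε : 0 ≤ ε) (hy : 0 ≤ y) (hm0 : ∀ γ', 0 ≤ m γ')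
    (hm : ∀ γ' ∈ L, m γ' ≤ ε * y ^ (supp γ').card * Real.exp (-(a' * (linSize (supp γ') : ℝ))))
    (haa : a'' ≤ a') (hθ : y * Real.exp a₁ * Real.exp (D * θ) ≤ θ)
    (hsmall : ε * Real.exp (a'' * (ν + 1)) * θ * ((D : ℝ) + 1) ≤ a₁) (γ : P) :
    ∑ γ' ∈ L with inc γ' γ, m γ' * Real.exp (a₁ * (supp γ').card + a'' * ((linSize (supp γ') : ℝ) + (ν + 1))) ≤
      a₁ * (supp γ).card := by
  classical
  set mt : P → ℝ := fun γ' => m γ' * Real.exp (a'' * ((linSize (supp γ') : ℝ) + (ν + 1))) with hmt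
  have hmt0 : ∀ γ', 0 ≤ mt γ' := fun γ' => mul_nonneg (hm0 γ') (Real.exp_nonneg _)
  have hεt : 0 ≤ ε * Real.exp (a'' * (ν + 1)) := by positivity
  have hmtb : ∀ γ' ∈ L, mt γ' ≤ ε * Real.exp (a'' * (ν + 1)) * y ^ (supp γ').card := by
    intro γ' hγ'
    have hls : (0 : ℝ) ≤ (linSize (supp γ') : ℝ) := Nat.cast_nonneg _
    have hexp : Real.exp (-(a' * (linSize (supp γ') : ℝ))) * Real.exp (a'' * ((linSize (supp γ') : ℝ) + (ν + 1))) ≤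
        Real.exp (a'' * (ν + 1)) := by
      rw [← Real.exp_add]
      exact Real.exp_le_exp.2 (by nlinarith)
    calc mt γ' = m γ' * Real.exp (a'' * ((linSize (supp γ') : ℝ) + (ν + 1))) := rfl
      _ ≤ ε * y ^ (supp γ').card * Real.exp (-(a' * (linSize (supp γ') : ℝ))) *
            Real.exp (a'' * ((linSize (supp γ') : ℝ) + (ν + 1))) :=
          mul_le_mul_of_nonneg_right (hm γ' hγ') (Real.exp_nonneg _)
      _ = ε * y ^ (supp γ').card * (Real.exp (-(a' * (linSize (supp γ') : ℝ))) *
            Real.exp (a'' * ((linSize (supp γ') : ℝ) + (ν + 1)))) := by ring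
      _ ≤ ε * y ^ (supp γ').card * Real.exp (a'' * (ν + 1)) :=
          mul_le_mul_of_nonneg_left hexp (mul_nonneg hε (pow_nonneg hy _))
      _ = ε * Real.exp (a'' * (ν + 1)) * y ^ (supp γ').card := by ring
  have hθ' : y * Real.exp (a₁ + 0) * Real.exp (D * θ) ≤ θ := by rw [add_zero]; exact hθ
  have h := kp_of_decay_touch (inc := inc) (adj := adj) D hD hsub hconn hinj htouch (m := mt) (d₁ := 0) hεt hy hmt0 hmtb hθ'
    hsmall γ
  have heq : ∀ γ', mt γ' * Real.exp (a₁ * (supp γ').card + 0 * (supp γ').card) =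
      m γ' * Real.exp (a₁ * (supp γ').card + a'' * ((linSize (supp γ') : ℝ) + (ν + 1))) := by
    intro γ'
    rw [zero_mul, add_zero, hmt, mul_assoc, ← Real.exp_add]
    congr 2; ring
  simpa only [heq] using h

variable {C : Carriers} {Gm : ClusterGeom C} {Bg : Type}

/-- **THE `hkp` CLAUSE FROM MIXED DECAY (kernel; over a support map).**  `S : Supported Gm (Fin ν → G) adj D`, a nonnegative majorant with
`M k (g k) U γ′ ≤ ε k·y^{#supp γ′}·e^{−a′·d(supp γ′)}` on every step volume at the occurring couplings, `a″ ≤ a′`, `y·e^{a₁}·e^{Dθ} ≤ θ`,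
`ε k·e^{a″(ν+1)}·θ·(D+1) ≤ a₁` ⇒ the Kotecký–Preiss clause with the weights `a = S.sizeWeight a₁`, `d = fun γ => a″·(d(supp γ) + (ν+1))` —
the SAME weights as `NE9LinSizeKP.kpClause_of_linSizeDecay`, so `decayExtract_linSize` ∕ `pinBudget_linSize` serve G1∕G2 unchanged.
[cite: KoteckyPreiss1986, (1)-(3); Balaban1988RG2Cluster, (2.19)-(2.20) p.16 and (2.39)-(2.41) p.21] -/
theorem kpClause_of_mixedDecay (S : Supported Gm (Fin ν → G) adj D)
    {W : Set (ℕ → ℝ)} {M : ℕ → ℝ → Bg → Gm.P → ℝ} {ε : ℕ → ℝ} {y a' a'' a₁ θ : ℝ} (hε : ∀ k, 0 ≤ ε k) (hy : 0 ≤ y)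
    (hM0 : ∀ k s U γ', 0 ≤ M k s U γ')
    (hdec : ∀ g ∈ W, ∀ (k : ℕ) (U : Bg) (X : C.Dom), C.scale X = k + 1 → ∀ γ' ∈ Gm.vol X,
      M k (g k) U γ' ≤ ε k * y ^ (S.supp γ').card * Real.exp (-(a' * (linSize (S.supp γ') : ℝ))))
    (haa : a'' ≤ a') (hθ : y * Real.exp a₁ * Real.exp (D * θ) ≤ θ)
    (hsmall : ∀ k, ε k * Real.exp (a'' * (ν + 1)) * θ * ((D : ℝ) + 1) ≤ a₁) :
    ∀ g ∈ W, ∀ (k : ℕ) (U : Bg) (X : C.Dom), C.scale X = k + 1 → ∀ γ ∈ Gm.vol X,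
      ∑ γ' ∈ Gm.vol X with Gm.inc γ' γ,
        M k (g k) U γ' * Real.exp (S.sizeWeight a₁ γ' + a'' * ((linSize (S.supp γ') : ℝ) + (ν + 1))) ≤
        S.sizeWeight a₁ γ := by
  classical
  intro g hg k U X hX γ _
  exact kp_of_mixedDecay_touch (inc := Gm.inc) S.deg (S.sub X) (S.conn X) (S.inj X) (S.touch X) (hε k) hy
    (hM0 k (g k) U) (hdec g hg k U X hX) haa hθ (hsmall k) γ

end KP

/-! ## §3 `TwoPointKP` from mixed decay of the segment majorant -/

section TwoPoint

variable {C : Carriers} {Gm : ClusterGeom C} {Bg : Type} {adj : (Fin ν → G) → (Fin ν → G) → Prop} [DecidableRel adj]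
  [Std.Symm adj] {D : ℕ}
variable {Pot : Type*} [NormedAddCommGroup Pot] [NormedSpace ℂ Pot] {Ω : Type*} [MeasurableSpace Ω]

/-- **TWO-POINT KP FROM MIXED DECAY OF THE SEGMENT MAJORANT (kernel).**  `T4HistoryLipschitzSegment.twoPointKP_of_avgExpLinear` with the KP
clause of §2 (the factor `2` of `2·segMajorant` inside the smallness): decay hypothesis
`segMajorant … γ′ ≤ ε k·y^{#supp γ′}·e^{−a′·d(supp γ′)}`, conditions `0 ≤ a″ ≤ a′`, `y·e^{a₁}·e^{Dθ} ≤ θ`, `2·ε k·e^{a″(ν+1)}·θ·(D+1) ≤ a₁`;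
weights `S.sizeWeight a₁`, `a″·(d(supp γ) + (ν+1))`.  The decay bound is DISPLAYED ((2.26) p. 17 → Lemma 3 (2.38) p. 20 TYPE with a volume
factor — see the module header's rider). [cite: Balaban1988RG2Cluster, (2.26) p.17, (2.37)-(2.41) pp.20-21; KoteckyPreiss1986, (1)-(3)] -/
theorem twoPointKP_of_avgExpLinear_mixedDecay (S : Supported Gm (Fin ν → G) adj D)
    {W : Set (ℕ → ℝ)} {μ : ℕ → ℝ → Bg → Gm.P → Measure Ω} {pre : ℕ → ℝ → Bg → Gm.P → Ω → ℂ}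
    {lin : ℕ → ℝ → Bg → Gm.P → Ω → (Pot →L[ℂ] ℂ)} {l e : ℕ → ℝ → Bg → Gm.P → Ω → ℝ} {lip : ℕ → ℝ} {𝒜 : ℕ → Set Pot}
    {ε : ℕ → ℝ} {y a' a'' a₁ θ : ℝ} (ha₁ : 0 ≤ a₁) (ha'' : 0 ≤ a'') (haa : a'' ≤ a') (hy : 0 ≤ y) (hlip : ∀ k, 0 < lip k)
    (hpre : ∀ k s U γ, AEStronglyMeasurable (pre k s U γ) (μ k s U γ))
    (hlinw : ∀ k s U γ (Q : Pot), AEStronglyMeasurable (fun ω => lin k s U γ ω Q) (μ k s U γ))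
    (hl : ∀ k s U γ ω, ‖lin k s U γ ω‖ ≤ l k s U γ ω)
    (he : ∀ k s U γ, ∀ Q ∈ 𝒜 k, ∀ ω, (lin k s U γ ω Q).re ≤ e k s U γ ω)
    (hint₀ : ∀ k s U γ, Integrable (fun ω => ‖pre k s U γ ω‖ * Real.exp (e k s U γ ω)) (μ k s U γ))
    (hint₁ : ∀ k s U γ, Integrable (fun ω => ‖pre k s U γ ω‖ * l k s U γ ω * Real.exp (e k s U γ ω)) (μ k s U γ))
    (hε : ∀ k, 0 ≤ ε k)
    (hdecay : ∀ g ∈ W, ∀ (k : ℕ) (U : Bg) (X : C.Dom), C.scale X = k + 1 → ∀ γ' ∈ Gm.vol X,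
      segMajorant μ pre l e lip k (g k) U γ' ≤ ε k * y ^ (S.supp γ').card * Real.exp (-(a' * (linSize (S.supp γ') : ℝ))))
    (hθ : y * Real.exp a₁ * Real.exp (D * θ) ≤ θ)
    (hsmall : ∀ k, 2 * ε k * Real.exp (a'' * (ν + 1)) * θ * ((D : ℝ) + 1) ≤ a₁) :
    TwoPointKP Gm W (Gm.avgExpLinearAct μ pre lin) 𝒜 (segMajorant μ pre l e lip) lip (S.sizeWeight a₁)
      (fun γ => a'' * ((linSize (S.supp γ) : ℝ) + (ν + 1))) := by
  have hl0 : ∀ k s U γ ω, 0 ≤ l k s U γ ω := fun k s U γ ω => (norm_nonneg _).trans (hl k s U γ ω)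
  have hkp := kpClause_of_mixedDecay S (W := W) (M := fun k s U γ => 2 * segMajorant μ pre l e lip k s U γ)
    (ε := fun k => 2 * ε k) (fun k => by have := hε k; positivity) hy
    (fun k s U γ' => mul_nonneg (by norm_num) (segMajorant_nonneg μ pre e hl0 (fun k => (hlip k).le) k s U γ'))
    (fun g hg k U X hX γ' hγ' => by
      have h := hdecay g hg k U X hX γ' hγ'
      show 2 * segMajorant μ pre l e lip k (g k) U γ' ≤
        2 * ε k * y ^ (S.supp γ').card * Real.exp (-(a' * (linSize (S.supp γ') : ℝ)))
      nlinarith [Real.exp_nonneg (-(a' * (linSize (S.supp γ') : ℝ))), pow_nonneg hy (S.supp γ').card])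
    haa hθ (fun k => by have := hsmall k; linarith)
  exact twoPointKP_of_avgExpLinear Gm (S.sizeWeight_nonneg ha₁) (fun γ => by positivity) hlip hpre hlinw hl he hint₀
    hint₁ hkp

open BoundedContinuousFunction in
/-- **TWO-POINT KP ON A BOX FROM MIXED DECAY (kernel).**  The box instance (`twoPointKP_of_avgEvalExpLinear_box` letters: activities
`T ↦ ∫ pre·exp(Σ_Y c_ω(Y)·T(pt_ω(Y))) dμ` on `Sp →ᵇ ℂ`, boxes `boxSet (β k)`, segment majorant from `coeffSum` ∕ `boxExponent`) with the KP
clause of §2.  This is the `hKP`-type binder of the NE9 END faces in the MIXED currency. [cite: Balaban1988RG2Cluster, (2.26) p.17, (2.37)-(2.41) pp.20-21; KoteckyPreiss1986, (1)-(3)] -/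
theorem twoPointKP_of_avgEvalExpLinear_box_mixedDecay {Sp : Type*} [TopologicalSpace Sp] [MeasurableSpace Sp]
    [OpensMeasurableSpace Sp] {F : Type*} [Fintype F]
    (S : Supported Gm (Fin ν → G) adj D) {W : Set (ℕ → ℝ)}
    {μ : ℕ → ℝ → Bg → Gm.P → Measure Ω} {pre : ℕ → ℝ → Bg → Gm.P → Ω → ℂ} {c : ℕ → ℝ → Bg → Gm.P → Ω → F → ℂ}
    {pt : ℕ → ℝ → Bg → Gm.P → Ω → F → Sp} {β : ℕ → Sp → ℝ} {lip ε : ℕ → ℝ} {y a' a'' a₁ θ : ℝ} (ha₁ : 0 ≤ a₁)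
    (ha'' : 0 ≤ a'') (haa : a'' ≤ a') (hy : 0 ≤ y) (hlip : ∀ k, 0 < lip k)
    (hpre : ∀ k s U γ, AEStronglyMeasurable (pre k s U γ) (μ k s U γ))
    (hc : ∀ k s U γ Y, AEStronglyMeasurable (fun ω => c k s U γ ω Y) (μ k s U γ))
    (hpt : ∀ k s U γ Y, Measurable fun ω => pt k s U γ ω Y)
    (hint₀ : ∀ k s U γ, Integrable (fun ω => ‖pre k s U γ ω‖ * Real.exp (boxExponent c pt β k s U γ ω)) (μ k s U γ))
    (hint₁ : ∀ k s U γ, Integrable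
      (fun ω => ‖pre k s U γ ω‖ * coeffSum c k s U γ ω * Real.exp (boxExponent c pt β k s U γ ω)) (μ k s U γ))
    (hε : ∀ k, 0 ≤ ε k)
    (hdecay : ∀ g ∈ W, ∀ (k : ℕ) (U : Bg) (X : C.Dom), C.scale X = k + 1 → ∀ γ' ∈ Gm.vol X,
      segMajorant μ pre (coeffSum c) (boxExponent c pt β) lip k (g k) U γ' ≤
        ε k * y ^ (S.supp γ').card * Real.exp (-(a' * (linSize (S.supp γ') : ℝ))))
    (hθ : y * Real.exp a₁ * Real.exp (D * θ) ≤ θ)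
    (hsmall : ∀ k, 2 * ε k * Real.exp (a'' * (ν + 1)) * θ * ((D : ℝ) + 1) ≤ a₁) :
    TwoPointKP Gm W (Gm.avgExpLinearAct μ pre fun k s U γ ω => evalFunctional (c k s U γ ω) (pt k s U γ ω))
      (fun k => boxSet (β k)) (segMajorant μ pre (coeffSum c) (boxExponent c pt β) lip) lip (S.sizeWeight a₁)
      (fun γ => a'' * ((linSize (S.supp γ) : ℝ) + (ν + 1))) :=
  twoPointKP_of_avgExpLinear_mixedDecay S ha₁ ha'' haa hy hlip hpre
    (fun k s U γ Q => aestronglyMeasurable_evalFunctional_apply (hc k s U γ) (hpt k s U γ) Q)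
    (fun _ _ _ _ _ => norm_evalFunctional_le _ _) (fun _ _ _ _ _ hQ _ => re_evalFunctional_le_of_mem_boxSet hQ)
    hint₀ hint₁ hε hdecay hθ hsmall

end TwoPoint

/-! ## §4 Non-vacuity at the T⁴ letters `ν = 4`, `D = 2ν = 8`, volume factor `y = e^{−17}` (= e^{−¼(κ₁−1)} at κ₁ = 69)

Compare `NE9LinSizeKP` §5 (d-currency): there the smallness forces `ε ≈ 10⁻¹²` through `2^(ν+1+2^ν) = 2²¹`; here `ε = 1∕3000` passes,
and the lip-side condition holds with `θ₀ = e^{−16}`.  Illustration of the letters only; nothing about Bałaban's constants is claimed. -/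

/-- the volume-entropy condition of §2∕§3 at `y = e^{−17}`, `a₁ = 1`, `D = 8`, `θ = 1`: `e^{−17}·e·e^{8} = e^{−8} ≤ 1`. [folklore] -/
example : Real.exp (-17) * Real.exp (1 : ℝ) * Real.exp (((8:ℕ) : ℝ) * 1) ≤ 1 := by
  rw [← Real.exp_add, ← Real.exp_add, Real.exp_le_one_iff]; norm_num

/-- the KP smallness of §3 at `a″ = 1`, `θ = 1`, `D = 8`, `ε = 1∕3000`: `2·(1∕3000)·e^{5}·1·9 ≤ 1` (`e^5 < 149`). [folklore] -/
example : 2 * (1 / 3000 : ℝ) * Real.exp (1 * (((4:ℕ) : ℝ) + 1)) * 1 * ((((8:ℕ) : ℝ)) + 1) ≤ 1 := by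
  have h5 : Real.exp (1 * (((4:ℕ) : ℝ) + 1)) = Real.exp 1 ^ 5 := by rw [← Real.exp_nat_mul]; norm_num
  rw [h5]
  have he := Real.exp_one_lt_d9
  have h3 : Real.exp 1 ^ 5 ≤ 149 := le_trans (by gcongr) (by norm_num : (2.7182818286 : ℝ) ^ 5 ≤ 149)
  nlinarith [pow_nonneg (Real.exp_pos 1).le 5]

/-- the lip-side condition of §1 at `y = e^{−17}`, `D = 8`, `θ₀ = e^{−16}`: `e^{−17}·e^{8e^{−16}} ≤ e^{−16}` (since `8e^{−16} ≤ 1`). [folklore] -/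
example : Real.exp (-17) * Real.exp (((8:ℕ) : ℝ) * Real.exp (-16)) ≤ Real.exp (-16) := by
  rw [← Real.exp_add, Real.exp_le_exp]
  have h8 : (8:ℝ) ≤ Real.exp 3 := by
    have h : Real.exp 3 = Real.exp 1 ^ 3 := by rw [← Real.exp_nat_mul]; norm_num
    rw [h]
    have h27 : (2.7182818283 : ℝ) ≤ Real.exp 1 := Real.exp_one_gt_d9.le
    nlinarith [pow_le_pow_left₀ (by norm_num : (0:ℝ) ≤ 2.7182818283) h27 3]
  have h16 : Real.exp (-16) ≤ 1 / 8 := by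
    have h1 : Real.exp (-16) ≤ Real.exp (-3) := Real.exp_le_exp.2 (by norm_num)
    have h2 : Real.exp (-3) ≤ 1 / 8 := by
      rw [Real.exp_neg, one_div]
      exact inv_anti₀ (by norm_num) h8
    exact h1.trans h2
  push_cast
  nlinarith [h16]

end Summit.QuantumFields.BalabanUV.T4Continuum.NE9MixedCurrencyKP

end
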